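import Summits.ABC.IUTFork.Repair.CandJoshi1BedScal
import Summits.ABC.IUTFork.Repair.CandJoshi1Tests
import Summits.ABC.IUTFork.Joshi.TestFundamentalEstimate
import HarnessLib

/-!
# IUT REPAIR branch (rung LADDER-ABC:A2.RP), rows RP-J01b/c — the KERNEL BRIDGE between block E's typing of Joshi's mechanism
# (`Joshi.ThetaValuationScaling ∧ QLocalNonpos ⟹ VolumeTransport`, abc-iut-E-t4) and block B's candidates H_J2 / H_J2ᵖˡ, with the
# two models that separate / align them (door (a) SCAL, door (b) standard point)

PROOF-ONLY record file (D-0012; no definition, no `Prop` fact) of the abc-iut cell, IUT REPAIR branch (seat abc-iut-rp-j1, answering E-t4's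
07:18:39Z cross-reference (1) «your (b) is implied by E's typed reading of the printed mechanism J := `Joshi.ThetaValuationScaling ∧ QLocalNonpos`
… via `Joshi.volumeTransport_of_scaling` … modulo admissibility/monotonicity»). TAKES NO SIDE on [IUTchIII] Cor. 3.12 and on no author; typed ≠
proved; every predicate named is a reading predicate, never asserted. Imports block E's `Joshi/TestFundamentalEstimate.lean` (p428059; it imports
no Repair file, so no cycle) and this seat's B3 files (`CandJoshi1BedScal` for the SCAL cells; `CandJoshi1Barrier` cited by name).

RESULTS (kernel, standard axioms):
* §1 **E ⟹ B** on every setting: `joshiVolumeDominance_of_volumeTransport` (abc-iut-c312's `VolumeTransport` + bridge hypotheses + `ThetaRegionsAdm`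
  ⟹ H_J2: the (Ind3)-enlarged Θ-region is the dominating possible image, by monotone log-volume), hence `joshi_E_implies_B`:
  `ThetaValuationScaling ∧ QLocalNonpos ⟹ H_J2 ∧ H_J2ᵖˡ` (E-t4's claim (1), now a theorem).
* §2 **under Step (x) the converse holds at the `⋃ₘ`-level**: `volumeDominance3_of_joshiVolumeDominance` (isometric indeterminacies ⟹ H_J2 gives
  `qLocal ≤ logvol(⋃ₘ Θ)`, by c312-1's `Thm311ToCor312.logvol_eq_of_mem_possibleImages`), so E's volume reading and B's H_J2 agree on every honest
  Step-(x) setting (and both fail there: `CandJoshi1Barrier`, p431708).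
* §3 **door (a) SEPARATES them**: at rp-s2's pinned SCALING setting (`ObstructionSS10.sSetting`; B-cells `CandJoshi1BedScal`, p432784) H_J2 and H_J2ᵖˡ
  HOLD (`CandJoshi1BedScal`) while `VolumeTransport` and `ThetaValuationScaling` FAIL (`scal_not_volumeTransport`,
  `scal_not_thetaValuationScaling`, `scal_B_not_E`): E's typing measures the Θ-REGION's own volume (no indeterminacy can help it), B's H_J2 measures a
  POSSIBLE IMAGE (a rescaling indeterminacy helps) — E's J excludes door (a), B's H_J2 admits it.
* §4 **door (b) ALIGNS them**: at this seat's Joshi STANDARD-POINT setting (`CandJoshi1Tests.stdSetting`: the q-datum `(±q^{ℓ*²})_j` in `K_1`-units)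
  E's `ThetaValuationScaling` HOLDS EXACTLY (`std_thetaValuationScaling`: `logvol(B_{j²}) = (j/ℓ*)²·qLocal` with `qLocal = −ℓ*²·log p`) together with
  `QLocalNonpos`, H_J2 and the Statement (`std_E_and_B`) — the two blocks' typings of ATS III Thm. 9.11.1 meet on the same toy, which is the SAT⊖[door (b)]
  model of record for RP-J01.
READING (neutral): the cross-block picture is consistent — E's mechanism typing is the door-(b)-only, Θ-region-volume form; B's H_J2 is its
indeterminacy-closed weakening; they coincide under Step (x) and at the standard point, and differ exactly on the scaling bed. Nothing here bears on
which reading of [IUTchIII] is right. [claim: Joshi2024ATSIII, status: disputed]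
-/

noncomputable section

open Set

namespace Summit.ABC.IUTFork.Repair.CandJoshi1BridgeE

open Thm311 Cor312 Cor312.Checks Cor312.IdentifiedNonVacuity Cor312Vol Literature.IUT.LogThetaLattice
open Summit.ABC.IUTFork.Joshi
open Summit.ABC.IUTFork.Repair.CandJoshi1 Summit.ABC.IUTFork.Repair.CandJoshi9 Summit.ABC.IUTFork.Repair.CandJoshi1BedScal

/-! ## 1. E ⟹ B on every setting -/

section General

variable {T : ThetaIndex} {S₀ : Situation T} (P₀ : Cor312.Setting S₀)

/-- **`VolumeTransport ⟹ H_J2`** under the bridge hypotheses and admissible Θ-regions: the Kummer image `thetaRegion m` of E's/c312's volume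
transport lies in the (Ind3)-enlarged region `⋃ₘ`, itself a possible image (identity indeterminacy), and log-volume is monotone on admissible
regions. [folklore] -/
theorem joshiVolumeDominance_of_volumeTransport (H : BridgeHyps P₀) (hadm : ThetaRegionsAdm P₀) (h : VolumeTransport P₀) :
    JoshiVolumeDominance P₀ := fun i vQ => by
  obtain ⟨m, hm⟩ := h i vQ
  refine ⟨P₀.thetaRegion3 _ vQ, P₀.thetaRegion3_mem_possibleImages _ vQ, hm.trans ?_⟩
  exact H.mono i vQ (hadm m i vQ) (H.image_adm i vQ _ (P₀.thetaRegion3_mem_possibleImages _ vQ))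
    (Set.subset_iUnion (fun m : ℤ => P₀.thetaRegion m (Setting.labelSucc i) vQ) m)

/-- **E ⟹ B (E-t4's cross-reference (1) as a theorem)**: block E's typed Joshi mechanism `ThetaValuationScaling ∧ QLocalNonpos` implies block B's
candidates H_J2 and H_J2ᵖˡ, under the bridge hypotheses and admissible Θ-regions. [claim: Joshi2024ATSIII, status: disputed] -/
theorem joshi_E_implies_B (H : BridgeHyps P₀) (hadm : ThetaRegionsAdm P₀) (hJ : ThetaValuationScaling P₀) (hq : QLocalNonpos P₀) :
    JoshiVolumeDominance P₀ ∧ JoshiPlaceDominance P₀ :=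
  have h2 := joshiVolumeDominance_of_volumeTransport P₀ H hadm (volumeTransport_of_scaling hJ hq)
  ⟨h2, placeDominance_of_joshiVolumeDominance P₀ h2⟩

/-! ## 2. Under Step (x) the two readings agree at the `⋃ₘ`-level -/

/-- **Step (x) ⟹ (H_J2 ⟹ volume dominance by the Θ-region itself)**: with isometric indeterminacies every possible image has the volume of `⋃ₘ Θ`
(c312-1's `Thm311ToCor312.logvol_eq_of_mem_possibleImages`, as in `CandJoshi1Barrier`), so H_J2 gives `qLocal ≤ logvol(⋃ₘ Θ)` in every packet of
`𝔽_l^⋇`. [claim: Mochizuki2012, status: disputed] -/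
theorem volumeDominance3_of_joshiVolumeDominance
    (hAdm : ∀ Φ ∈ S₀.L.Ind1Family ∪ S₀.L.Ind2Family, ∀ j vQ (A : Set (S₀.L.Packet j vQ)),
      (S₀.D P₀.n).Adm j vQ A ↔ (S₀.D P₀.n).Adm j vQ (Φ j vQ '' A))
    (hvol : (S₀.D P₀.n).LogvolInvariant) (hθ : ∀ (i : Fin T.lstar) (vQ : T.VQ), (S₀.D P₀.n).Adm _ vQ (P₀.thetaRegion3 (Setting.labelSucc i) vQ))
    (h : JoshiVolumeDominance P₀) (i : Fin T.lstar) (vQ : T.VQ) :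
    P₀.qLocal (Setting.labelSucc i) vQ ≤ (S₀.D P₀.n).logvol _ vQ (P₀.thetaRegion3 (Setting.labelSucc i) vQ) := by
  obtain ⟨U, hU, hle⟩ := h i vQ
  rwa [(Thm311ToCor312.logvol_eq_of_mem_possibleImages P₀ hAdm hvol (hθ i vQ) hU).2] at hle

end General

/-! ## 3. Door (a) separates E's reading from B's: the scaling bed -/

section Scal

open Cor312Vol.NaiveWitness Cor312Vol.UnitWitness Cor312Vol.PinnedWitness
open Summit.ABC.IUTFork.Repair.ScalarShells Summit.ABC.IUTFork.Repair.ObstructionSS10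

variable (p : ℕ) [hp : Fact p.Prime]

/-- The label `2` of `𝔽_l^⋇` (`i = 1`) is nonzero and has `j² = 4`. [folklore] -/
theorem labelTwo_facts : (Setting.labelSucc (⟨1, by decide⟩ : Fin toyIndex.lstar) : toyIndex.Label) ≠ 0 ∧
    jsq (Setting.labelSucc (⟨1, by decide⟩ : Fin toyIndex.lstar) : toyIndex.Label) = 4 :=
  ⟨Setting.labelSucc_ne_zero _, by decide⟩

/-- **At SCAL, c312's / E's `VolumeTransport` FAILS**: at label `2` every Kummer image of the Θ-pilot is `B_4` of volume `−4·log p < −log p = qLocal`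
— no indeterminacy enters `VolumeTransport`, so the rescaling that makes H_J2 true there cannot help. [folklore] -/
theorem scal_not_volumeTransport : ¬ VolumeTransport (sSetting p) := by
  intro h
  obtain ⟨hj, hjsq⟩ := labelTwo_facts
  obtain ⟨m, hm⟩ := h ⟨1, by decide⟩ ()
  rw [sSetting_qLocal p hj, sSetting_thetaRegion, if_neg hj, hjsq] at hm
  have hv : ((sLattice p).D (sSetting p).n).logvol (Setting.labelSucc (⟨1, by decide⟩ : Fin toyIndex.lstar)) ()
      (sBall p ⊤ (Setting.labelSucc (⟨1, by decide⟩ : Fin toyIndex.lstar)) () 4) = -(4 : ℝ) * Real.log p := by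
    show sVol p ⊤ _ () (sBall p ⊤ _ () 4) = _
    rw [sVol_sBall]; push_cast; ring
  rw [hv] at hm
  have hl := log_p_pos p
  linarith

/-- **At SCAL, E's `ThetaValuationScaling` FAILS** (at label `2`: `logvol(B_4) = −4·log p ≠ (2/2)²·(−log p)`). [folklore] -/
theorem scal_not_thetaValuationScaling : ¬ ThetaValuationScaling (sSetting p) := by
  intro h
  obtain ⟨hj, hjsq⟩ := labelTwo_facts
  obtain ⟨m, hm⟩ := h ⟨1, by decide⟩ ()
  rw [sSetting_qLocal p hj, sSetting_thetaRegion, if_neg hj, hjsq] at hm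
  have hv : ((sLattice p).D (sSetting p).n).logvol (Setting.labelSucc (⟨1, by decide⟩ : Fin toyIndex.lstar)) ()
      (sBall p ⊤ (Setting.labelSucc (⟨1, by decide⟩ : Fin toyIndex.lstar)) () 4) = -(4 : ℝ) * Real.log p := by
    show sVol p ⊤ _ () (sBall p ⊤ _ () 4) = _
    rw [sVol_sBall]; push_cast; ring
  have hw : scalingWeight toyIndex (⟨1, by decide⟩ : Fin toyIndex.lstar) = 1 := by
    unfold scalingWeight
    rw [show (toyIndex.lstar : ℝ) = 2 from by exact_mod_cast (rfl : toyIndex.lstar = 2)]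
    norm_num
  rw [hv, hw] at hm
  have hl := log_p_pos p
  linarith

/-- **Door (a) SEPARATES E from B**: at the pinned scaling setting H_J2 and H_J2ᵖˡ HOLD (B; cf. `CandJoshi1BedScal.scal_cells`) while `VolumeTransport`
and `ThetaValuationScaling` FAIL (E). [folklore] -/
theorem scal_B_not_E :
    JoshiVolumeDominance (sSetting p) ∧ JoshiPlaceDominance (sSetting p) ∧
      ¬ VolumeTransport (sSetting p) ∧ ¬ ThetaValuationScaling (sSetting p) :=
  ⟨scal_joshiVolumeDominance p, scal_placeDominance p, scal_not_volumeTransport p, scal_not_thetaValuationScaling p⟩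

end Scal

/-! ## 4. Door (b) aligns them: the Joshi standard-point setting -/

section Std

open Cor312Vol.NaiveWitness Cor312Vol.PinnedWitness Cor312Vol.PinnedHonest Summit.ABC.IUTFork.Repair.CandJoshi1

variable (p : ℕ) [hp : Fact p.Prime]

/-- **At the standard-point setting E's `ThetaValuationScaling` HOLDS EXACTLY**: `logvol(B_{j²}) = −j²·log p = (j/2)²·(−4·log p) = (j/ℓ*)²·qLocal`
— Joshi's (9.9.4) valuation scaling, read in `K_1`-units, is literally this seat's SAT⊖ model. [claim: Joshi2024ATSIII, status: disputed] -/
theorem std_thetaValuationScaling : ThetaValuationScaling (stdSetting p) := by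
  intro i vQ
  refine ⟨0, ?_⟩
  rw [std_qLocal_labelSucc]
  have hθ : (stdSetting p).thetaRegion 0 (Setting.labelSucc i) vQ = pBall p _ vQ (jsq (Setting.labelSucc i)) := withQDatum_thetaRegion p _ _ 0 _ vQ
  rw [hθ]
  show pVol p _ vQ (pBall p _ vQ (jsq (Setting.labelSucc i))) = _
  rw [pVol_pBall]
  unfold scalingWeight jsq
  rw [show (toyIndex.lstar : ℝ) = 2 from by exact_mod_cast (rfl : toyIndex.lstar = 2),
    show ((Setting.labelSucc i : toyIndex.Label) : ℕ) = (i : ℕ) + 1 from rfl]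
  push_cast
  ring

/-- At the standard-point setting `QLocalNonpos` holds (`qLocal = −4·log p ≤ 0`). [folklore] -/
theorem std_qLocalNonpos : QLocalNonpos (stdSetting p) := fun i vQ => by
  rw [std_qLocal_labelSucc]
  have hl := log_p_pos p
  linarith

/-- **Door (b) ALIGNS E and B**: at the standard-point setting E's `ThetaValuationScaling ∧ QLocalNonpos`, c312's `VolumeTransport`, B's H_J2 ∧ H_J2ᵖˡ
and the Statement all HOLD (and S fails there: `CandJoshi1Tests.std_not_pilotKummerIndRelated`). [claim: Joshi2024ATSIII, status: disputed] -/
theorem std_E_and_B :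
    ThetaValuationScaling (stdSetting p) ∧ QLocalNonpos (stdSetting p) ∧ VolumeTransport (stdSetting p) ∧
      JoshiVolumeDominance (stdSetting p) ∧ JoshiPlaceDominance (stdSetting p) ∧ (stdSetting p).Statement ∧
      ¬ PilotKummerIndRelated (naiveFull p).toLatticeSituation (stdSetting p) (GluedMonoids.Naive.ballOfMonoid p) (fun v _ => stdQDatum p v) :=
  ⟨std_thetaValuationScaling p, std_qLocalNonpos p, volumeTransport_of_scaling (std_thetaValuationScaling p) (std_qLocalNonpos p),
    std_joshiVolumeDominance p, placeDominance_of_joshiVolumeDominance _ (std_joshiVolumeDominance p), std_statement p,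
    std_not_pilotKummerIndRelated p⟩

end Std

end Summit.ABC.IUTFork.Repair.CandJoshi1BridgeE

end
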